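import Mathlib
import HarnessLib
import Summits.ResolutionOfSingularities.ResolutionOfSingularities.Theorems.HomologicalConductorPersistenceMonomialCurveExact
import Summits.ResolutionOfSingularities.ResolutionOfSingularities.Theorems.HomologicalConductorPersistenceArenaSandwich
import Summits.ResolutionOfSingularities.ResolutionOfSingularities.Theorems.HomologicalConductorPersistenceBranchedCoverDescent
import Literature.RingTheory.CohomologyAnnihilator.RegularRing
import Literature.RingTheory.CohomologyAnnihilator.Localization

/-!
# The exact cohomology annihilator of a monomial branch in the `k[z,t]/(zᵐ − εᵐtⁿ)` presentation, and of the
# cA-arena `k[x,y,z,t]/(xy − zᵐ + εᵐtⁿ)` over it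

Route `ResolutionOfSingularities/HomologicalConductor`, chain W4.4b, rung S-2 `PersistenceSurface`
(stmt-ResolutionOfSingularities-19970); seat res-L1-w44b-stub-2 (gen 5).  [OURS · L1 w44b; AI-written, weaker than
expert review; NOT a statement of the manuscript under study (Hironaka 2017), and no statement of that manuscript
is used.]

`…PersistenceMonomialCurveExact` (p562244) computes `ca` of the monomial branch on the `AdjoinRoot` model
`k[t][z]/(zᵐ − εᵐtⁿ)`.  The chain's curve and arena files (`…PersistenceMonomialCusp` p542769,
`…PersistenceArenaSandwich` p552485) use the presentation `R₀ = k[z,t]/(h)`, `h = zᵐ − εᵐtⁿ ∈ MvPolynomial (Fin 2) k`,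
with the parametrisation `θ : z ↦ ετⁿ, t ↦ τᵐ`.  This file transports the exact formula:

* `aeval_eq_zero_of_mem_span`, `lift_quotientMap_mk`, `injective_quotientMap`, `surjective_quotientMap` — the
  comparison map `ψ̄ : R₀ → AdjoinRoot f` (`z ↦ z̄`, `t ↦ t̄`) is a ring ISOMORAdjoinRoot.lift ((Polynomial.expand k m : Polynomial k →ₐ[k] Polynomial k) : Polynomial k →+* Polynomial k)
        (C ε * X ^ n) (eval₂_f_eq_zero k ε m n)SM intertwining `θ̄` and `φ`;
* `ca` along ring isomorphisms, elementwise: `ArenaDescent.mem_cohomologyAnnihilator_iff_of_ringEquiv` (p550165) and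
  the levelled `mem_cohomologyAnnihilatorOfDegree_iff_of_ringEquiv` (tree `ringEquiv_apply_mem_cohomologyAnnihilatorOfDegree`);
* **`mk_mem_cohomologyAnnihilator_iff_X_pow_dvd`** — for `g ∈ k[z,t]`: `ḡ ∈ ca(R₀) ↔ τ^{(m−1)(n−1)} ∣ θ(g)`;
  `mem_cohomologyAnnihilator_iff_X_pow_dvd_lift` (any `r ∈ R₀`, via the descended `θ̄`); levelled `…OfDegree…` (`N ≥ 2`);
  **`mk_monomial_mem_cohomologyAnnihilator_iff`** — `z̄ᵇt̄ᵃ ∈ ca(R₀) ↔ (m−1)(n−1) ≤ nb + ma` (the `⇐` is p542769's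
  `mk_monomial_mem_cohomologyAnnihilatorOfDegree_two`; the `⇒` is new: e.g. `z̄, t̄ ∉ ca` for `E₆`, all levels);
* **`arena_mem_cohomologyAnnihilator_iff_X_pow_dvd`** — THE cA-ARENA OVER A MONOMIAL BRANCH, EXACTLY: for
  `T = k[x,y,z,t]/(xy − h(z,t))`, `char k ≠ 2`: `s ∈ ca(T) ↔ τ^{(m−1)(n−1)} ∣ θ̄(ρ₀ s)` (`ρ₀ : x,y ↦ 0`), by the
  ENABLING FORMULA `ArenaSandwich.mem_cohomologyAnnihilator_iff` (res-L1-w44b-stub-2 g4) + the exact curve side; in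
  particular the K-C3 stage `xy = z³ + t⁴` (`(m,n,ε) = (3,4,−1)`): `ca = (x, y, z², zt, t²)` membership-wise at all
  levels, now with BOTH inclusions from one criterion.

* **`doublePoint_mem_cohomologyAnnihilator_iff_X_pow_dvd`** — THE ONE-SQUARE RULE, EXACTLY, for the coprime Brieskorn
  double points `T = k[z,t][x]/(x² + zᵐ − εᵐtⁿ)` (`char k ≠ 2`): `s ∈ ca(T) ↔ τ^{(m−1)(n−1)} ∣ θ̄(π s)` (`π : x ↦ 0`), by
  `BranchedCoverDescent.cohomologyAnnihilator_eq_comap` (m = 2, res-L1-w44b-stub-2 g4, fact-free) + the exact curve side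
  — i.e. «`ca(x² + g) = (x) + 𝔠(g)`» (S2-BRIEF R4) in the kernel for `g = zᵐ − εᵐtⁿ`: `A_{2j}` `(x, z, tʲ)`, `E₆` `(x, z², zt, t²)`,
  `E₈` `(x, z², zt, t³)`, … as membership criteria at every level.

References (mechanism only): S. B. Iyengar, R. Takahashi, IMRN 2016 §2 [`IyengarTakahashi2014`]; Ö. Esentepe,
J. Algebra 541 (2020) Thm 4.4 / Thm 5.4 [`Esentepe2020`] (statement shapes only; nothing used as a premise).
-/

noncomputable section

-- single-problem summit: the doubled namespace component `ResolutionOfSingularities` is forced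
set_option linter.dupNamespace false

namespace Summit.ResolutionOfSingularities.ResolutionOfSingularities.Theorems.HomologicalConductor.MonomialCurveQuotient

open Polynomial Literature.RingTheory.CohomologyAnnihilator
open Summit.ResolutionOfSingularities.ResolutionOfSingularities.Theorems.HomologicalConductor.MonomialCusp
  (param_eq_zero_of_mem_span mem_span_of_param_eq_zero param_X_zero param_X_one)
open Summit.ResolutionOfSingularities.ResolutionOfSingularities.Theorems.HomologicalConductor.MonomialCurveExact
open Summit.ResolutionOfSingularities.ResolutionOfSingularities.Theorems.HomologicalConductor.ArenaSandwich
open Summit.ResolutionOfSingularities.ResolutionOfSingularities.Theorems.HomologicalConductor.ArenaDescent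
  (mem_cohomologyAnnihilator_iff_of_ringEquiv)
open Summit.ResolutionOfSingularities.ResolutionOfSingularities.Theorems.HomologicalConductor.BranchedCoverDescent
  (cohomologyAnnihilator_eq_comap)

universe u

variable (k : Type u) [Field k] (ε : k) (m n : ℕ)

/-! ## §1 The comparison `ψ̄ : k[z,t]/(h) → k[t][z]/(f)` -/

/-- `z̄ᵐ = εᵐ t̄ⁿ` in `AdjoinRoot f`: the comparison map kills `h = zᵐ − εᵐtⁿ`. [folklore] -/
theorem aeval_h_eq_zero : (MvPolynomial.aeval (R := k) (![AdjoinRoot.root (X ^ m - C (C (ε ^ m) * X ^ n) : Polynomial (Polynomial k)), AdjoinRoot.of (X ^ m - C (C (ε ^ m) * X ^ n) : Polynomial (Polynomial k)) X] : Fin 2 → AdjoinRoot (X ^ m - C (C (ε ^ m) * X ^ n) : Polynomial (Polynomial k)))) (MvPolynomial.X 0 ^ m - MvPolynomial.C (ε ^ m) * MvPolynomial.X 1 ^ n : MvPolynomial (Fin 2) k) = 0 := by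
  have key : AdjoinRoot.root (X ^ m - C (C (ε ^ m) * X ^ n) : Polynomial (Polynomial k)) ^ m - AdjoinRoot.of (X ^ m - C (C (ε ^ m) * X ^ n) : Polynomial (Polynomial k)) (C (ε ^ m) * X ^ n) = 0 := by
    rw [← AdjoinRoot.mk_X, ← map_pow (AdjoinRoot.mk (X ^ m - C (C (ε ^ m) * X ^ n) : Polynomial (Polynomial k))),
      show AdjoinRoot.of (X ^ m - C (C (ε ^ m) * X ^ n) : Polynomial (Polynomial k)) (C (ε ^ m) * X ^ n) = AdjoinRoot.mk (X ^ m - C (C (ε ^ m) * X ^ n) : Polynomial (Polynomial k)) (C (C (ε ^ m) * X ^ n)) from rfl,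
      ← map_sub (AdjoinRoot.mk (X ^ m - C (C (ε ^ m) * X ^ n) : Polynomial (Polynomial k))), AdjoinRoot.mk_self]
  rw [map_mul (AdjoinRoot.of (X ^ m - C (C (ε ^ m) * X ^ n) : Polynomial (Polynomial k))), map_pow (AdjoinRoot.of (X ^ m - C (C (ε ^ m) * X ^ n) : Polynomial (Polynomial k)))] at key
  rw [map_sub (MvPolynomial.aeval (R := k) (![AdjoinRoot.root (X ^ m - C (C (ε ^ m) * X ^ n) : Polynomial (Polynomial k)), AdjoinRoot.of (X ^ m - C (C (ε ^ m) * X ^ n) : Polynomial (Polynomial k)) X] : Fin 2 → AdjoinRoot (X ^ m - C (C (ε ^ m) * X ^ n) : Polynomial (Polynomial k)))), map_mul (MvPolynomial.aeval (R := k) (![AdjoinRoot.root (X ^ m - C (C (ε ^ m) * X ^ n) : Polynomial (Polynomial k)), AdjoinRoot.of (X ^ m - C (C (ε ^ m) * X ^ n) : Polynomial (Polynomial k)) X] : Fin 2 → AdjoinRoot (X ^ m - C (C (ε ^ m) * X ^ n) : Polynomial (Polynomial k)))), map_pow (MvPolynomial.aeval (R := k) (![AdjoinRoot.root (X ^ m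 - C (C (ε ^ m) * X ^ n) : Polynomial (Polynomial k)), AdjoinRoot.of (X ^ m - C (C (ε ^ m) * X ^ n) : Polynomial (Polynomial k)) X] : Fin 2 → AdjoinRoot (X ^ m - C (C (ε ^ m) * X ^ n) : Polynomial (Polynomial k)))), map_pow (MvPolynomial.aeval (R := k) (![AdjoinRoot.root (X ^ m - C (C (ε ^ m) * X ^ n) : Polynomial (Polynomial k)), AdjoinRoot.of (X ^ m - C (C (ε ^ m) * X ^ n) : Polynomial (Polynomial k)) X] : Fin 2 → AdjoinRoot (X ^ m - C (C (ε ^ m) * X ^ n) : Polynomial (Polynomial k)))), MvPolynomial.aeval_X, MvPolynomial.aeval_X,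
    MvPolynomial.algHom_C]
  simp only [Matrix.cons_val_zero, Matrix.cons_val_one]
  rw [IsScalarTower.algebraMap_apply k (Polynomial k) (AdjoinRoot (X ^ m - C (C (ε ^ m) * X ^ n) : Polynomial (Polynomial k))), AdjoinRoot.algebraMap_eq,
    Polynomial.algebraMap_eq]
  exact key

/-- The comparison map kills the ideal `(h)`. [folklore] -/
theorem aeval_eq_zero_of_mem_span {a : MvPolynomial (Fin 2) k} (ha : a ∈ Ideal.span {(MvPolynomial.X 0 ^ m - MvPolynomial.C (ε ^ m) * MvPolynomial.X 1 ^ n : MvPolynomial (Fin 2) k)}) :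
    ((MvPolynomial.aeval (R := k) (![AdjoinRoot.root (X ^ m - C (C (ε ^ m) * X ^ n) : Polynomial (Polynomial k)), AdjoinRoot.of (X ^ m - C (C (ε ^ m) * X ^ n) : Polynomial (Polynomial k)) X] : Fin 2 → AdjoinRoot (X ^ m - C (C (ε ^ m) * X ^ n) : Polynomial (Polynomial k))))).toRingHom a = 0 := by
  obtain ⟨b, rfl⟩ := Ideal.mem_span_singleton'.mp ha
  rw [AlgHom.toRingHom_eq_coe, RingHom.coe_coe, map_mul (MvPolynomial.aeval (R := k) (![AdjoinRoot.root (X ^ m - C (C (ε ^ m) * X ^ n) : Polynomial (Polynomial k)), AdjoinRoot.of (X ^ m - C (C (ε ^ m) * X ^ n) : Polynomial (Polynomial k)) X] : Fin 2 → AdjoinRoot (X ^ m - C (C (ε ^ m) * X ^ n) : Polynomial (Polynomial k)))), aeval_h_eq_zero, mul_zero]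

/-- `φ ∘ ψ̄ ∘ mk = θ`: the comparison intertwines the two parametrisations. [folklore] -/
theorem lift_quotientMap_mk (g : MvPolynomial (Fin 2) k) :
    AdjoinRoot.lift ((Polynomial.expand k m : Polynomial k →ₐ[k] Polynomial k) : Polynomial k →+* Polynomial k)
        (C ε * X ^ n) (eval₂_f_eq_zero k ε m n) (Ideal.Quotient.lift (Ideal.span {(MvPolynomial.X 0 ^ m - MvPolynomial.C (ε ^ m) * MvPolynomial.X 1 ^ n : MvPolynomial (Fin 2) k)}) ((MvPolynomial.aeval (R := k) (![AdjoinRoot.root (X ^ m - C (C (ε ^ m) * X ^ n) : Polynomial (Polynomial k)), AdjoinRoot.of (X ^ m - C (C (ε ^ m) * X ^ n) : Polynomial (Polynomial k)) X] : Fin 2 → AdjoinRoot (X ^ m - C (C (ε ^ m) * X ^ n) : Polynomial (Polynomial k))))).toRingHom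
        (fun _ ha => aeval_eq_zero_of_mem_span k ε m n ha) (Ideal.Quotient.mk _ g)) = (MvPolynomial.aeval (R := k) (![C ε * X ^ n, X ^ m] : Fin 2 → Polynomial k)) g := by
  rw [Ideal.Quotient.lift_mk, AlgHom.toRingHom_eq_coe, RingHom.coe_coe, lift_aeval]

/-- `ψ̄` is injective (`ε ≠ 0`, `m, n` coprime, `m > 0`): `φ ψ̄ ḡ = θ g = 0 ⇒ g ∈ (h)` (p542769's kernel lemma). [folklore] -/
theorem injective_quotientMap (hε : ε ≠ 0) (hmn : Nat.Coprime m n) (hm : 0 < m) : Function.Injective (Ideal.Quotient.lift (Ideal.span {(MvPolynomial.X 0 ^ m - MvPolynomial.C (ε ^ m) * MvPolynomial.X 1 ^ n : MvPolynomial (Fin 2) k)}) ((MvPolynomial.aeval (R := k) (![AdjoinRoot.root (X ^ m - C (C (ε ^ m) * X ^ n) : Polynomial (Polynomial k)), AdjoinRoot.of (X ^ m - C (C (ε ^ m) * X ^ n) : Polynomial (Polynomial k)) X] : Fin 2 → AdjoinRoot (X ^ m - C (C (ε ^ m) * X ^ n) : Polynomial (Polynomial k))))).toRingHom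
        (fun _ ha => aeval_eq_zero_of_mem_span k ε m n ha)) := by
  rw [injective_iff_map_eq_zero]
  intro r hr
  obtain ⟨g, rfl⟩ := Ideal.Quotient.mk_surjective r
  have h0 : (MvPolynomial.aeval (R := k) (![C ε * X ^ n, X ^ m] : Fin 2 → Polynomial k)) g = 0 := by
    rw [← lift_quotientMap_mk, hr, map_zero]
  exact Ideal.Quotient.eq_zero_iff_mem.mpr (mem_span_of_param_eq_zero k ε m n hε hmn hm g h0)

/-- `ψ̄` is surjective: `Ḡ(z̄, t̄) ↦ mk G` for `G ∈ k[t][X]` read in `k[z,t]` (`X ↦ z`, `t ↦ t`). [folklore] -/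
theorem surjective_quotientMap : Function.Surjective (Ideal.Quotient.lift (Ideal.span {(MvPolynomial.X 0 ^ m - MvPolynomial.C (ε ^ m) * MvPolynomial.X 1 ^ n : MvPolynomial (Fin 2) k)}) ((MvPolynomial.aeval (R := k) (![AdjoinRoot.root (X ^ m - C (C (ε ^ m) * X ^ n) : Polynomial (Polynomial k)), AdjoinRoot.of (X ^ m - C (C (ε ^ m) * X ^ n) : Polynomial (Polynomial k)) X] : Fin 2 → AdjoinRoot (X ^ m - C (C (ε ^ m) * X ^ n) : Polynomial (Polynomial k))))).toRingHom
        (fun _ ha => aeval_eq_zero_of_mem_span k ε m n ha)) := by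
  intro y
  obtain ⟨G, rfl⟩ := AdjoinRoot.mk_surjective y
  -- read `G ∈ k[t][X]` in `k[z,t]`
  let κ : Polynomial (Polynomial k) →+* MvPolynomial (Fin 2) k :=
    Polynomial.eval₂RingHom (Polynomial.eval₂RingHom (MvPolynomial.C) (MvPolynomial.X 1)) (MvPolynomial.X 0)
  refine ⟨Ideal.Quotient.mk _ (κ G), ?_⟩
  rw [Ideal.Quotient.lift_mk]
  have key : ((MvPolynomial.aeval (R := k) (![AdjoinRoot.root (X ^ m - C (C (ε ^ m) * X ^ n) : Polynomial (Polynomial k)), AdjoinRoot.of (X ^ m - C (C (ε ^ m) * X ^ n) : Polynomial (Polynomial k)) X] : Fin 2 → AdjoinRoot (X ^ m - C (C (ε ^ m) * X ^ n) : Polynomial (Polynomial k))))).toRingHom.comp κ = AdjoinRoot.mk (X ^ m - C (C (ε ^ m) * X ^ n) : Polynomial (Polynomial k)) := by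
    refine Polynomial.ringHom_ext (fun p => ?_) (?_)
    · rw [RingHom.comp_apply, AlgHom.toRingHom_eq_coe, RingHom.coe_coe]
      change (MvPolynomial.aeval (R := k) (![AdjoinRoot.root (X ^ m - C (C (ε ^ m) * X ^ n) : Polynomial (Polynomial k)), AdjoinRoot.of (X ^ m - C (C (ε ^ m) * X ^ n) : Polynomial (Polynomial k)) X] : Fin 2 → AdjoinRoot (X ^ m - C (C (ε ^ m) * X ^ n) : Polynomial (Polynomial k)))) (Polynomial.eval₂RingHom (Polynomial.eval₂RingHom MvPolynomial.C (MvPolynomial.X 1))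
        (MvPolynomial.X 0) (C p)) = _
      rw [Polynomial.coe_eval₂RingHom, Polynomial.eval₂_C, AdjoinRoot.mk_C]
      -- inner: `p(t) ↦ p(t̄) = of p`
      have inner : (((MvPolynomial.aeval (R := k) (![AdjoinRoot.root (X ^ m - C (C (ε ^ m) * X ^ n) : Polynomial (Polynomial k)), AdjoinRoot.of (X ^ m - C (C (ε ^ m) * X ^ n) : Polynomial (Polynomial k)) X] : Fin 2 → AdjoinRoot (X ^ m - C (C (ε ^ m) * X ^ n) : Polynomial (Polynomial k))))).toRingHom.comp (Polynomial.eval₂RingHom MvPolynomial.C (MvPolynomial.X 1))) =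
          AdjoinRoot.of (X ^ m - C (C (ε ^ m) * X ^ n) : Polynomial (Polynomial k)) := by
        refine Polynomial.ringHom_ext (fun a => ?_) ?_
        · rw [RingHom.comp_apply, AlgHom.toRingHom_eq_coe, RingHom.coe_coe, Polynomial.coe_eval₂RingHom,
            Polynomial.eval₂_C, MvPolynomial.algHom_C, IsScalarTower.algebraMap_apply k (Polynomial k) (AdjoinRoot (X ^ m - C (C (ε ^ m) * X ^ n) : Polynomial (Polynomial k))),
            AdjoinRoot.algebraMap_eq, Polynomial.algebraMap_eq]
        · rw [RingHom.comp_apply, AlgHom.toRingHom_eq_coe, RingHom.coe_coe, Polynomial.coe_eval₂RingHom,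
            Polynomial.eval₂_X, MvPolynomial.aeval_X]
          rfl
      have := congrArg (fun ψ : Polynomial k →+* AdjoinRoot (X ^ m - C (C (ε ^ m) * X ^ n) : Polynomial (Polynomial k)) => ψ p) inner
      simpa only [RingHom.comp_apply, AlgHom.toRingHom_eq_coe, RingHom.coe_coe] using this
    · rw [RingHom.comp_apply, AlgHom.toRingHom_eq_coe, RingHom.coe_coe]
      change (MvPolynomial.aeval (R := k) (![AdjoinRoot.root (X ^ m - C (C (ε ^ m) * X ^ n) : Polynomial (Polynomial k)), AdjoinRoot.of (X ^ m - C (C (ε ^ m) * X ^ n) : Polynomial (Polynomial k)) X] : Fin 2 → AdjoinRoot (X ^ m - C (C (ε ^ m) * X ^ n) : Polynomial (Polynomial k)))) (Polynomial.eval₂RingHom (Polynomial.eval₂RingHom MvPolynomial.C (MvPolynomial.X 1))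
        (MvPolynomial.X 0) X) = _
      rw [Polynomial.coe_eval₂RingHom, Polynomial.eval₂_X, MvPolynomial.aeval_X, AdjoinRoot.mk_X]
      rfl
  have := congrArg (fun ψ : Polynomial (Polynomial k) →+* AdjoinRoot (X ^ m - C (C (ε ^ m) * X ^ n) : Polynomial (Polynomial k)) => ψ G) key
  simpa only [RingHom.comp_apply] using this

/-- `θ̄ = φ ∘ ψ̄` on the quotient. [folklore] -/
theorem lift_comp_quotientMap :
    (AdjoinRoot.lift ((Polynomial.expand k m : Polynomial k →ₐ[k] Polynomial k) : Polynomial k →+* Polynomial k)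
        (C ε * X ^ n) (eval₂_f_eq_zero k ε m n)).comp (Ideal.Quotient.lift (Ideal.span {(MvPolynomial.X 0 ^ m - MvPolynomial.C (ε ^ m) * MvPolynomial.X 1 ^ n : MvPolynomial (Fin 2) k)}) ((MvPolynomial.aeval (R := k) (![AdjoinRoot.root (X ^ m - C (C (ε ^ m) * X ^ n) : Polynomial (Polynomial k)), AdjoinRoot.of (X ^ m - C (C (ε ^ m) * X ^ n) : Polynomial (Polynomial k)) X] : Fin 2 → AdjoinRoot (X ^ m - C (C (ε ^ m) * X ^ n) : Polynomial (Polynomial k))))).toRingHom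
        (fun _ ha => aeval_eq_zero_of_mem_span k ε m n ha)) = Ideal.Quotient.lift (Ideal.span {(MvPolynomial.X 0 ^ m - MvPolynomial.C (ε ^ m) * MvPolynomial.X 1 ^ n : MvPolynomial (Fin 2) k)})
        ((MvPolynomial.aeval (R := k) (![C ε * X ^ n, X ^ m] : Fin 2 → Polynomial k))).toRingHom (fun _ ha => param_eq_zero_of_mem_span k ε m n ha) := by
  refine Ideal.Quotient.ringHom_ext (RingHom.ext fun g => ?_)
  rw [RingHom.comp_apply, RingHom.comp_apply, lift_quotientMap_mk, RingHom.comp_apply, Ideal.Quotient.lift_mk]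
  rfl

/-! ## §2 `ca` along ring isomorphisms, levelled -/

/-- `x ∈ caⁿ(R) ↔ e x ∈ caⁿ(S)` for a ring isomorphism `e`. [folklore] -/
theorem mem_cohomologyAnnihilatorOfDegree_iff_of_ringEquiv {R S : Type u} [CommRing R] [CommRing S] (e : R ≃+* S)
    (N : ℕ) (x : R) : x ∈ cohomologyAnnihilatorOfDegree R N ↔ e x ∈ cohomologyAnnihilatorOfDegree S N := by
  constructor
  · exact ringEquiv_apply_mem_cohomologyAnnihilatorOfDegree e
  · intro h
    simpa using ringEquiv_apply_mem_cohomologyAnnihilatorOfDegree e.symm h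

/-! ## §3 The exact formula in the `k[z,t]/(h)` presentation -/

/-- **`r ∈ ca(k[z,t]/(zᵐ − εᵐtⁿ)) ↔ τ^{(m−1)(n−1)} ∣ θ̄(r)`** (`ε ≠ 0`, coprime `m, n > 1`), `θ̄` the descended
parametrisation. [folklore] -/
theorem mem_cohomologyAnnihilator_iff_X_pow_dvd_lift (hε : ε ≠ 0) (hmn : Nat.Coprime m n) (hm : 1 < m) (hn : 1 < n)
    (r : MvPolynomial (Fin 2) k ⧸ Ideal.span {(MvPolynomial.X 0 ^ m - MvPolynomial.C (ε ^ m) * MvPolynomial.X 1 ^ n : MvPolynomial (Fin 2) k)}) :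
    r ∈ cohomologyAnnihilator (MvPolynomial (Fin 2) k ⧸ Ideal.span {(MvPolynomial.X 0 ^ m - MvPolynomial.C (ε ^ m) * MvPolynomial.X 1 ^ n : MvPolynomial (Fin 2) k)}) ↔
      X ^ ((m - 1) * (n - 1)) ∣ Ideal.Quotient.lift (Ideal.span {(MvPolynomial.X 0 ^ m - MvPolynomial.C (ε ^ m) * MvPolynomial.X 1 ^ n : MvPolynomial (Fin 2) k)})
        ((MvPolynomial.aeval (R := k) (![C ε * X ^ n, X ^ m] : Fin 2 → Polynomial k))).toRingHom (fun _ ha => param_eq_zero_of_mem_span k ε m n ha) r := by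
  let e := RingEquiv.ofBijective (Ideal.Quotient.lift (Ideal.span {(MvPolynomial.X 0 ^ m - MvPolynomial.C (ε ^ m) * MvPolynomial.X 1 ^ n : MvPolynomial (Fin 2) k)}) ((MvPolynomial.aeval (R := k) (![AdjoinRoot.root (X ^ m - C (C (ε ^ m) * X ^ n) : Polynomial (Polynomial k)), AdjoinRoot.of (X ^ m - C (C (ε ^ m) * X ^ n) : Polynomial (Polynomial k)) X] : Fin 2 → AdjoinRoot (X ^ m - C (C (ε ^ m) * X ^ n) : Polynomial (Polynomial k))))).toRingHom
        (fun _ ha => aeval_eq_zero_of_mem_span k ε m n ha))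
    ⟨injective_quotientMap k ε m n hε hmn (by omega), surjective_quotientMap k ε m n⟩
  rw [mem_cohomologyAnnihilator_iff_of_ringEquiv e, RingEquiv.ofBijective_apply,
    mem_cohomologyAnnihilator_iff_X_pow_dvd k ε m n hε hmn hm hn, ← RingHom.comp_apply, lift_comp_quotientMap]

/-- **`ḡ ∈ ca(k[z,t]/(zᵐ − εᵐtⁿ)) ↔ τ^{(m−1)(n−1)} ∣ g(ετⁿ, τᵐ)`** for `g ∈ k[z,t]`. [folklore] -/
theorem mk_mem_cohomologyAnnihilator_iff_X_pow_dvd (hε : ε ≠ 0) (hmn : Nat.Coprime m n) (hm : 1 < m) (hn : 1 < n)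
    (g : MvPolynomial (Fin 2) k) :
    Ideal.Quotient.mk (Ideal.span {(MvPolynomial.X 0 ^ m - MvPolynomial.C (ε ^ m) * MvPolynomial.X 1 ^ n : MvPolynomial (Fin 2) k)}) g ∈ cohomologyAnnihilator (MvPolynomial (Fin 2) k ⧸ Ideal.span {(MvPolynomial.X 0 ^ m - MvPolynomial.C (ε ^ m) * MvPolynomial.X 1 ^ n : MvPolynomial (Fin 2) k)}) ↔
      X ^ ((m - 1) * (n - 1)) ∣ (MvPolynomial.aeval (R := k) (![C ε * X ^ n, X ^ m] : Fin 2 → Polynomial k)) g := by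
  rw [mem_cohomologyAnnihilator_iff_X_pow_dvd_lift k ε m n hε hmn hm hn, Ideal.Quotient.lift_mk]
  rfl

/-- Levelled: `ḡ ∈ caᴺ ↔ τ^{(m−1)(n−1)} ∣ θ(g)` for every `N ≥ 2`. [folklore] -/
theorem mk_mem_cohomologyAnnihilatorOfDegree_iff_X_pow_dvd (hε : ε ≠ 0) (hmn : Nat.Coprime m n) (hm : 1 < m)
    (hn : 1 < n) {N : ℕ} (hN : 2 ≤ N) (g : MvPolynomial (Fin 2) k) :
    Ideal.Quotient.mk (Ideal.span {(MvPolynomial.X 0 ^ m - MvPolynomial.C (ε ^ m) * MvPolynomial.X 1 ^ n : MvPolynomial (Fin 2) k)}) g ∈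
        cohomologyAnnihilatorOfDegree (MvPolynomial (Fin 2) k ⧸ Ideal.span {(MvPolynomial.X 0 ^ m - MvPolynomial.C (ε ^ m) * MvPolynomial.X 1 ^ n : MvPolynomial (Fin 2) k)}) N ↔
      X ^ ((m - 1) * (n - 1)) ∣ (MvPolynomial.aeval (R := k) (![C ε * X ^ n, X ^ m] : Fin 2 → Polynomial k)) g := by
  let e := RingEquiv.ofBijective (Ideal.Quotient.lift (Ideal.span {(MvPolynomial.X 0 ^ m - MvPolynomial.C (ε ^ m) * MvPolynomial.X 1 ^ n : MvPolynomial (Fin 2) k)}) ((MvPolynomial.aeval (R := k) (![AdjoinRoot.root (X ^ m - C (C (ε ^ m) * X ^ n) : Polynomial (Polynomial k)), AdjoinRoot.of (X ^ m - C (C (ε ^ m) * X ^ n) : Polynomial (Polynomial k)) X] : Fin 2 → AdjoinRoot (X ^ m - C (C (ε ^ m) * X ^ n) : Polynomial (Polynomial k))))).toRingHom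
        (fun _ ha => aeval_eq_zero_of_mem_span k ε m n ha))
    ⟨injective_quotientMap k ε m n hε hmn (by omega), surjective_quotientMap k ε m n⟩
  rw [mem_cohomologyAnnihilatorOfDegree_iff_of_ringEquiv e, RingEquiv.ofBijective_apply,
    mem_cohomologyAnnihilatorOfDegree_iff_X_pow_dvd k ε m n hε hmn hm hn hN, lift_quotientMap_mk]

/-- **MONOMIALS**: `z̄ᵇ t̄ᵃ ∈ ca(k[z,t]/(zᵐ − εᵐtⁿ)) ↔ (m−1)(n−1) ≤ nb + ma` (`θ(zᵇtᵃ) = εᵇ τ^{nb+ma}`). [folklore] -/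
theorem mk_monomial_mem_cohomologyAnnihilator_iff (hε : ε ≠ 0) (hmn : Nat.Coprime m n) (hm : 1 < m) (hn : 1 < n)
    (a b : ℕ) :
    Ideal.Quotient.mk (Ideal.span {(MvPolynomial.X 0 ^ m - MvPolynomial.C (ε ^ m) * MvPolynomial.X 1 ^ n : MvPolynomial (Fin 2) k)}) (MvPolynomial.X 0 ^ b * MvPolynomial.X 1 ^ a) ∈
        cohomologyAnnihilator (MvPolynomial (Fin 2) k ⧸ Ideal.span {(MvPolynomial.X 0 ^ m - MvPolynomial.C (ε ^ m) * MvPolynomial.X 1 ^ n : MvPolynomial (Fin 2) k)}) ↔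
      (m - 1) * (n - 1) ≤ n * b + m * a := by
  rw [mk_mem_cohomologyAnnihilator_iff_X_pow_dvd k ε m n hε hmn hm hn,
    map_mul (MvPolynomial.aeval (R := k) (![C ε * X ^ n, X ^ m] : Fin 2 → Polynomial k)), map_pow (MvPolynomial.aeval (R := k) (![C ε * X ^ n, X ^ m] : Fin 2 → Polynomial k)), map_pow (MvPolynomial.aeval (R := k) (![C ε * X ^ n, X ^ m] : Fin 2 → Polynomial k)),
    param_X_zero, param_X_one, mul_pow, ← Polynomial.C_pow, ← pow_mul, ← pow_mul, mul_assoc, ← pow_add,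
    Polynomial.X_pow_dvd_iff]
  constructor
  · intro h
    by_contra hlt
    have := h (n * b + m * a) (by omega)
    rw [Polynomial.coeff_C_mul, Polynomial.coeff_X_pow_self, mul_one] at this
    exact pow_ne_zero _ hε this
  · intro h d hd
    rw [Polynomial.coeff_C_mul, Polynomial.coeff_X_pow, if_neg (by omega), mul_zero]

/-! ## §4 The cA-arena over a monomial branch, exactly -/

/-- `h = zᵐ − εᵐtⁿ ≠ 0` (`m > 0`, `n > 0`: the coefficient of `zᵐ` is `1`). [folklore] -/
theorem h_ne_zero (hm : 0 < m) : (MvPolynomial.X 0 ^ m - MvPolynomial.C (ε ^ m) * MvPolynomial.X 1 ^ n : MvPolynomial (Fin 2) k) ≠ 0 := by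
  intro h0
  have h1 := congrArg (MvPolynomial.coeff (Finsupp.single 0 m)) h0
  rw [MvPolynomial.coeff_sub, MvPolynomial.coeff_zero, MvPolynomial.coeff_X_pow, if_pos rfl,
    MvPolynomial.X_pow_eq_monomial, MvPolynomial.coeff_C_mul, MvPolynomial.coeff_monomial, if_neg, mul_zero,
    sub_zero] at h1
  · exact one_ne_zero h1
  · intro h2
    have := Finsupp.ext_iff.mp h2 0
    rw [Finsupp.single_eq_same, Finsupp.single_eq_of_ne (by decide)] at this
    omega

/-- **THE cA-ARENA OVER A MONOMIAL BRANCH, EXACTLY.**  `k` a field with `2 ≠ 0`, `ε ≠ 0`, coprime `m, n > 1`,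
`T = k[x,y,z,t]/(xy − (zᵐ − εᵐtⁿ))`.  Then for every `s ∈ T`:
`s ∈ ca(T) ↔ τ^{(m−1)(n−1)} ∣ θ̄(ρ₀ s)`, where `ρ₀ : T → k[z,t]/(h)` kills `x, y` (`ArenaSandwich`) and `θ̄` is the
descended parametrisation — the enabling formula `ca(T) = (x,y) + ι(ca(C_h))` with the exact curve side `ca(C_h) = 𝔠`.
[folklore] -/
theorem arena_mem_cohomologyAnnihilator_iff_X_pow_dvd (h2 : (2 : k) ≠ 0) (hε : ε ≠ 0) (hmn : Nat.Coprime m n)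
    (hm : 1 < m) (hn : 1 < n)
    (s : MvPolynomial (Fin 4) k ⧸ Ideal.span {MvPolynomial.X 0 * MvPolynomial.X 1 -
        (MvPolynomial.aeval fun j : Fin 2 => (MvPolynomial.X j.succ.succ : MvPolynomial (Fin 4) k)) (MvPolynomial.X 0 ^ m - MvPolynomial.C (ε ^ m) * MvPolynomial.X 1 ^ n : MvPolynomial (Fin 2) k)}) :
    s ∈ cohomologyAnnihilator (MvPolynomial (Fin 4) k ⧸ Ideal.span {MvPolynomial.X 0 * MvPolynomial.X 1 -
        (MvPolynomial.aeval fun j : Fin 2 => (MvPolynomial.X j.succ.succ : MvPolynomial (Fin 4) k)) (MvPolynomial.X 0 ^ m - MvPolynomial.C (ε ^ m) * MvPolynomial.X 1 ^ n : MvPolynomial (Fin 2) k)}) ↔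
      X ^ ((m - 1) * (n - 1)) ∣
        Ideal.Quotient.lift (Ideal.span {(MvPolynomial.X 0 ^ m - MvPolynomial.C (ε ^ m) * MvPolynomial.X 1 ^ n : MvPolynomial (Fin 2) k)})
        ((MvPolynomial.aeval (R := k) (![C ε * X ^ n, X ^ m] : Fin 2 → Polynomial k))).toRingHom (fun _ ha => param_eq_zero_of_mem_span k ε m n ha) (Ideal.Quotient.lift _ _ (mk_aeval_proj_eq_zero_of_mem k 1 (MvPolynomial.X 0 ^ m - MvPolynomial.C (ε ^ m) * MvPolynomial.X 1 ^ n : MvPolynomial (Fin 2) k)) s) := by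
  rw [ArenaSandwich.mem_cohomologyAnnihilator_iff k 1 h2 (MvPolynomial.X 0 ^ m - MvPolynomial.C (ε ^ m) * MvPolynomial.X 1 ^ n : MvPolynomial (Fin 2) k) (h_ne_zero k ε m n (by omega)) s,
    mem_cohomologyAnnihilator_iff_X_pow_dvd_lift k ε m n hε hmn hm hn]

/-! ## §5 The one-square rule for coprime Brieskorn double points, exactly -/

/-- `ca⁴(k[z,t][X]) = ⊤`: `k[z,t][X]` is regular of Krull dimension `3`. [folklore] -/
theorem cohomologyAnnihilatorOfDegree_polynomial_mvPolynomial_two_eq_top :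
    cohomologyAnnihilatorOfDegree (Polynomial (MvPolynomial (Fin 2) k)) (2 + 2) = ⊤ := by
  apply cohomologyAnnihilatorOfDegree_eq_top_of_isRegularRing
  rw [Polynomial.ringKrullDim_of_isNoetherianRing, MvPolynomial.ringKrullDim_of_isNoetherianRing,
    ringKrullDim_eq_zero_of_field, zero_add, Nat.card_eq_fintype_card, Fintype.card_fin]
  exact le_of_eq (by norm_cast)

/-- **THE ONE-SQUARE RULE, EXACTLY, for coprime Brieskorn double points.**  `k` a field with `2 ≠ 0`, `ε ≠ 0`,
coprime `m, n > 1`, `T = k[z,t][x]/(x² + (zᵐ − εᵐtⁿ))` (`AdjoinRoot (X² + C h)` over `k[z,t]`).  Then for every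
`s ∈ T`: `s ∈ ca(T) ↔ τ^{(m−1)(n−1)} ∣ θ̄(π s)`, `π : T → k[z,t]/(h)` killing `x` — «`ca(x² + g) = (x) + 𝔠(g)`» for
`g = zᵐ − εᵐtⁿ`, both inclusions, every level. [folklore] -/
theorem doublePoint_mem_cohomologyAnnihilator_iff_X_pow_dvd (h2 : (2 : k) ≠ 0) (hε : ε ≠ 0) (hmn : Nat.Coprime m n)
    (hm : 1 < m) (hn : 1 < n)
    (s : AdjoinRoot (X ^ 2 + C (MvPolynomial.X 0 ^ m - MvPolynomial.C (ε ^ m) * MvPolynomial.X 1 ^ n : MvPolynomial (Fin 2) k) : Polynomial (MvPolynomial (Fin 2) k))) :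
    s ∈ cohomologyAnnihilator (AdjoinRoot (X ^ 2 + C (MvPolynomial.X 0 ^ m - MvPolynomial.C (ε ^ m) * MvPolynomial.X 1 ^ n : MvPolynomial (Fin 2) k) : Polynomial (MvPolynomial (Fin 2) k))) ↔
      X ^ ((m - 1) * (n - 1)) ∣
        Ideal.Quotient.lift (Ideal.span {(MvPolynomial.X 0 ^ m - MvPolynomial.C (ε ^ m) * MvPolynomial.X 1 ^ n : MvPolynomial (Fin 2) k)})
        ((MvPolynomial.aeval (R := k) (![C ε * X ^ n, X ^ m] : Fin 2 → Polynomial k))).toRingHom (fun _ ha => param_eq_zero_of_mem_span k ε m n ha) (AdjoinRoot.lift (Ideal.Quotient.mk (Ideal.span {(MvPolynomial.X 0 ^ m - MvPolynomial.C (ε ^ m) * MvPolynomial.X 1 ^ n : MvPolynomial (Fin 2) k)})) (0 : MvPolynomial (Fin 2) k ⧸ Ideal.span {(MvPolynomial.X 0 ^ m - MvPolynomial.C (ε ^ m) * MvPolynomial.X 1 ^ n : MvPolynomial (Fin 2) k)})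
          (by rw [eval₂_add, eval₂_X_pow, eval₂_C, zero_pow (by omega), zero_add,
                Ideal.Quotient.eq_zero_iff_mem]; exact Ideal.mem_span_singleton_self _) s) := by
  have hf : (MvPolynomial.X 0 ^ m - MvPolynomial.C (ε ^ m) * MvPolynomial.X 1 ^ n : MvPolynomial (Fin 2) k) ∈ nonZeroDivisors (MvPolynomial (Fin 2) k) :=
    mem_nonZeroDivisors_of_ne_zero (h_ne_zero k ε m n (by omega))
  have hu : IsUnit (2 : MvPolynomial (Fin 2) k) := by
    have := (isUnit_iff_ne_zero.mpr h2).map (MvPolynomial.C : k →+* MvPolynomial (Fin 2) k)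
    rwa [map_ofNat] at this
  rw [cohomologyAnnihilator_eq_comap (MvPolynomial.X 0 ^ m - MvPolynomial.C (ε ^ m) * MvPolynomial.X 1 ^ n : MvPolynomial (Fin 2) k) hf (d := 2) (cohomologyAnnihilatorOfDegree_polynomial_mvPolynomial_two_eq_top k)
    hu, Ideal.mem_comap, mem_cohomologyAnnihilator_iff_X_pow_dvd_lift k ε m n hε hmn hm hn]

end Summit.ResolutionOfSingularities.ResolutionOfSingularities.Theorems.HomologicalConductor.MonomialCurveQuotient

end
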